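import Summits.CriticalPhenomena.CardyFormulaZ2.Theorems.CardyBoundaryCoulombGasHalfPlaneMarkDensityLawWindowBelowOne
import Summits.CriticalPhenomena.CardyFormulaZ2.Theorems.CardyBoundaryCoulombGasHalfPlaneMarkDensityLawPrimalArch
import Summits.CriticalPhenomena.CardyFormulaZ2.Theorems.CardyBoundaryCoulombGasHalfPlaneMarkDensityLawDualEdgeShares
import Summits.CriticalPhenomena.CardyFormulaZ2.Theorems.CardyBoundaryCoulombGasHalfPlaneMarkDensityLawIsolationIndep
import Literature.Probability.Percolation.AnnulusCrossingBoundProofs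

/-!
# `HalfPlaneMarkDensityLaw` (crux stmt-CriticalPhenomena-5661), line `Sketch`, lead c12-0, wave 2 assembly:
# the macroscopic WINDOW lower bound for the leftmost point, and STRICT monotonicity of joint
# subsequential limits in the fourth mark

With `L_n` the `⌊cn⌋`-most vertex of `[⌊cn⌋,∞)×{0}` joined inside `ℤ×ℕ` to the source arc
`A_n = [⌊an⌋,⌊bn⌋]×{0}` (`a < b < c`), and `P_n(a,b,c,y) = P[A_n ↔ [⌊cn⌋,⌊yn⌋]×{0} in ℤ×ℕ]`:
* `stub_windowLowerBound` — for `c < x < y`, `P[⌊xn⌋ < L_n ≤ ⌊yn⌋] = P_n(a,b,c,y) − P_n(a,b,c,x) ≥ c₀ > 0`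
  eventually in `n`.  Construction: a dual U — dual top–bottom crossings of the face boxes over
  `(b + (c−b)/3, b + 2(c−b)/3)` and over `(x, x + (y−x)/3)`, joined by a dual left–right crossing of a bar
  (`stub_dualU_prob`: probability `≥ cU`, law of the dual configuration + Harris–FKG + RSW) — is one
  moat-to-moat dual walk (`stub_dualU_walk`), which seals `[⌊cn⌋, ⌊xn⌋]×{0}` from `A_n` (winding numbers,
  `stub_dualSeal` after `SelfDual.moat_end_trapped`); an independent primal arch over it joins `A_n` to
  `[⌊(x + 2(y−x)/3)n⌋, ⌊yn⌋]×{0}` (`stub_primalArch`, `≥ cA`); the two are read off disjoint edge sets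
  (`DeterminedBy.preimage_dualConfig`, `stub_dualEdge_shares`), so `P ≥ cU·cA`.
* `stub_jointLimit_strictMono` — consequently every joint subsequential scaling limit `G` of the
  half-plane four-arc crossing probability of critical bond-`ℤ²` (`…SubsequentialLimits.lean`) is
  STRICTLY increasing in its fourth mark: `G(a,b,c,x) < G(a,b,c,y)` for `c < x < y` (the tree had
  `≤`, positivity and `→ 0` at `c⁺`; by the reflection symmetry `…Symmetry.lean` it is likewise strictly
  decreasing in the first mark).  No flat stretches: the crux's density `∂₄G` vanishes on no interval.
* Bonus, the SECOND mark: `dualSeal_right` (trapping with the reversed dual walk), `window2_lowerBound`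
  (`P_n(a,b',c,y) − P_n(a,b,c,y) ≥ c₀` for `b < b'`: a dual U around the short source arc + an independent
  primal arch from `[⌊b''n⌋,⌊b'n⌋]`), `jointLimit_strictMono_second` (`G(a,b,c,y) < G(a,b',c,y)`); with
  the reflection symmetry, joint limits are strictly monotone in EACH of the four marks.
-/

noncomputable section

namespace Summit.CriticalPhenomena.CardyFormulaZ2.Cruxes.HalfPlaneMarkDensityLaw.SketchLine

open Literature.Probability.Percolation Literature.Probability.LatticeModels
open MeasureTheory Filter Set SimpleGraph
open scoped Topology
open Summit.CriticalPhenomena.CardyFormulaZ2.Theorems.HalfPlaneMarkDensityLaw.Negative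

namespace Window

/-! ### Assembly (lead): the window lower bound -/

/-- **STUB W6 (registered signature): the macroscopic window lower bound.** For `a < b < c < x < y`,
`P[⌊xn⌋ < L_n ≤ ⌊yn⌋] = P_n(a,b,c,y) − P_n(a,b,c,x) ≥ c₀ > 0` eventually: a dual U (`stub_dualU_prob`,
`stub_dualU_walk`) seals `[⌊cn⌋,⌊xn⌋]` from the source arc (`stub_dualSeal`), an independent primal
arch (`stub_primalArch`) joins the source arc to `[⌊x''n⌋,⌊yn⌋]`. [folklore] -/
theorem stub_windowLowerBound :
    ∀ (a b c x y : ℝ), a < b → b < c → c < x → x < y →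
      ∃ c₀ : ℝ, 0 < c₀ ∧ ∀ᶠ n : ℕ in atTop,
        c₀ ≤ μ.real (openCrossing halfPlane (arcA a b n) (rowIcc ⌊c * n⌋ ⌊y * n⌋) \
          openCrossing halfPlane (arcA a b n) (rowIcc ⌊c * n⌋ ⌊x * n⌋)) := by
  intro a b c x y hab hbc hcx hxy
  classical
  -- parameters of the dual U and of the primal arch
  set g₁ : ℝ := b + (c - b) / 3 with hg₁
  set g₂ : ℝ := b + 2 * (c - b) / 3 with hg₂
  set x' : ℝ := x + (y - x) / 3 with hx'
  set x'' : ℝ := x + 2 * (y - x) / 3 with hx''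
  have hbg₁ : b < g₁ := by rw [hg₁]; linarith
  have hg₁₂ : g₁ < g₂ := by rw [hg₁, hg₂]; linarith
  have hg₂c : g₂ < c := by rw [hg₂]; linarith
  have hg₂x : g₂ < x := by linarith
  have hxx' : x < x' := by rw [hx']; linarith
  have hx'x'' : x' < x'' := by rw [hx', hx'']; linarith
  have hx''y : x'' < y := by rw [hx'']; linarith
  obtain ⟨cU, hcU0, hU⟩ := stub_dualU_prob g₁ g₂ x x' (1 / 2) 1 hg₁₂ hg₂x hxx' (by norm_num) (by norm_num)
  obtain ⟨cA, hcA0, hA⟩ := stub_primalArch a b x'' y 1 hab (by linarith) hx''y one_pos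
  refine ⟨cU * cA, mul_pos hcU0 hcA0, ?_⟩
  filter_upwards [hU, hA, eventually_floor_add_two_le hbg₁, eventually_floor_add_two_le hg₁₂,
    eventually_floor_add_two_le hg₂c, eventually_floor_add_two_le hcx, eventually_floor_add_two_le hxx',
    eventually_floor_add_two_le hx'x'', eventually_floor_add_two_le hx''y, eventually_floor_add_two_le hab,
    eventually_one_le_floor (one_half_pos : (0:ℝ) < 1 / 2), eventually_one_le_floor (one_pos : (0:ℝ) < 1)]
    with n hUn hAn e1 e2 e3 e4 e5 e6 e7 e8 e9 e10
  -- names for the integer data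
  set G₁ := ⌊g₁ * n⌋ with hG₁
  set G₂ := ⌊g₂ * n⌋ with hG₂
  set X := ⌊x * n⌋ with hX
  set X' := ⌊x' * n⌋ with hX'
  set X'' := ⌊x'' * n⌋ with hX''
  set Y := ⌊y * n⌋ with hY
  set Hh := ⌊(1 / 2 : ℝ) * n⌋ with hHh
  set H := ⌊(1 : ℝ) * n⌋ with hH
  have hHhH : Hh ≤ H := Int.floor_le_floor (by nlinarith [(Nat.cast_nonneg n : (0:ℝ) ≤ n)])
  -- the two events
  set U : Set (BondConfig (Site 2)) := dualConfig ⁻¹' (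
      openCrossing {z : Site 2 | G₁ ≤ z 0 ∧ z 0 ≤ G₂ ∧ -1 ≤ z 1 ∧ z 1 ≤ H} {z : Site 2 | z 1 = -1} {z : Site 2 | z 1 = H} ∩
      openCrossing {z : Site 2 | G₁ ≤ z 0 ∧ z 0 ≤ X' ∧ Hh ≤ z 1 ∧ z 1 ≤ H} {z : Site 2 | z 0 = G₁} {z : Site 2 | z 0 = X'} ∩
      openCrossing {z : Site 2 | X ≤ z 0 ∧ z 0 ≤ X' ∧ -1 ≤ z 1 ∧ z 1 ≤ H} {z : Site 2 | z 1 = -1} {z : Site 2 | z 1 = H})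
    with hUdef
  set T : Set (Site 2) := {v : Site 2 | ⌊a * n⌋ ≤ v 0 ∧ v 0 ≤ ⌊b * n⌋ ∧ 0 ≤ v 1 ∧ v 1 ≤ 3 * H} ∪
      {v : Site 2 | ⌊a * n⌋ ≤ v 0 ∧ v 0 ≤ Y ∧ 2 * H ≤ v 1 ∧ v 1 ≤ 3 * H} ∪
      {v : Site 2 | X'' ≤ v 0 ∧ v 0 ≤ Y ∧ 0 ≤ v 1 ∧ v 1 ≤ 3 * H} with hTdef
  set Ar : Set (BondConfig (Site 2)) := openCrossing T (arcA a b n) (rowIcc X'' Y) with hArdef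
  -- (1) deterministic inclusion (a.e.): `U ∩ Ar ⊆ W`
  have hincl : ∀ᵐ ω ∂μ, ω ∈ U ∩ Ar →
      ω ∈ openCrossing halfPlane (arcA a b n) (rowIcc ⌊c * n⌋ Y) \ openCrossing halfPlane (arcA a b n) (rowIcc ⌊c * n⌋ X) := by
    rw [show μ = bondPercolation (zdGraph 2) half from rfl]
    filter_upwards [ae_subset_edgeSet (zdGraph 2) half] with ω hω hωUA
    obtain ⟨hωU, hωA⟩ := hωUA
    constructor
    · -- the arch joins the source arc to `[X'', Y] ⊆ [⌊cn⌋, Y]` inside `T ⊆ H`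
      have hTH : T ⊆ halfPlane := by
        rintro v ((⟨-, -, h3, -⟩ | ⟨-, -, h3, -⟩) | ⟨-, -, h3, -⟩)
        · exact h3
        · show (0 : ℤ) ≤ v 1; omega
        · exact h3
      have hrow : rowIcc X'' Y ⊆ rowIcc ⌊c * n⌋ Y := fun v ⟨h1, h2, h3⟩ => ⟨h1, by omega, h3⟩
      exact openCrossing_mono hTH subset_rfl hrow hωA
    · -- the dual U seals `[⌊cn⌋, X]` from the source arc
      obtain ⟨⟨hL, hB⟩, hR⟩ := hωU
      obtain ⟨p₁, p₂, hp₁, hp₁', hp₂, hp₂', Q, hQω, hQ1, hQ0⟩ :=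
        stub_dualU_walk ω G₁ G₂ X X' Hh H (by omega) (by omega) (by omega) (by omega) hHhH hL hB hR
      rintro ⟨u, ⟨hu1, -, hub⟩, v, ⟨hv1, hvc, hvx⟩, huv⟩
      exact stub_dualSeal ω hω p₁ p₂ (by omega) ⟨Q, hQω, hQ1, hQ0⟩ u v hu1 hv1 (by omega) (by omega) (by omega) huv
  -- (2) independence: `U` and `Ar` are determined by disjoint edge sets
  set Φ : Finset (Site 2) := Finset.Icc ![G₁, -1] ![X', H] with hΦ
  have hmemΦ : ∀ z : Site 2, z ∈ Φ ↔ G₁ ≤ z 0 ∧ z 0 ≤ X' ∧ -1 ≤ z 1 ∧ z 1 ≤ H := by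
    intro z
    simp only [hΦ, Finset.mem_Icc, Pi.le_def, Fin.forall_fin_two, Matrix.cons_val_zero, Matrix.cons_val_one]
    tauto
  have hTfin : T.Finite := by
    refine (Set.finite_Icc (![⌊a * n⌋, 0] : Site 2) ![Y, 3 * H]).subset ?_
    intro v hv
    simp only [Set.mem_Icc, Pi.le_def, Fin.forall_fin_two, Matrix.cons_val_zero, Matrix.cons_val_one]
    rcases hv with (⟨h1, h2, h3, h4⟩ | ⟨h1, h2, h3, h4⟩) | ⟨h1, h2, h3, h4⟩ <;> refine ⟨⟨?_, ?_⟩, ?_, ?_⟩ <;> omega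
  have hdetU : DeterminedBy U (dualEdge ⁻¹' (↑Φ.sym2 : Set (Sym2 (Site 2)))) := by
    rw [hUdef]
    refine DeterminedBy.preimage_dualConfig ?_
    have hbox : ∀ (S : Set (Site 2)) (hS : S.Finite) (A B : Set (Site 2)), S ⊆ ↑Φ →
        DeterminedBy (openCrossing S A B) (↑Φ.sym2 : Set (Sym2 (Site 2))) := by
      intro S hS A B hSΦ
      refine (Indep.determinedBy_openCrossing_finite hS A B).mono ?_
      intro e he
      rw [Finset.mem_coe, Finset.mem_sym2_iff] at he ⊢
      intro w hw
      exact hSΦ (by simpa using he w hw)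
    refine ((hbox _ ?_ _ _ ?_).inter (hbox _ ?_ _ _ ?_)).inter (hbox _ ?_ _ _ ?_)
    · exact (Set.finite_Icc (![G₁, -1] : Site 2) ![G₂, H]).subset fun z ⟨h1, h2, h3, h4⟩ => by
        simp only [Set.mem_Icc, Pi.le_def, Fin.forall_fin_two, Matrix.cons_val_zero, Matrix.cons_val_one]; omega
    · intro z ⟨h1, h2, h3, h4⟩; rw [Finset.mem_coe, hmemΦ]; omega
    · exact (Set.finite_Icc (![G₁, Hh] : Site 2) ![X', H]).subset fun z ⟨h1, h2, h3, h4⟩ => by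
        simp only [Set.mem_Icc, Pi.le_def, Fin.forall_fin_two, Matrix.cons_val_zero, Matrix.cons_val_one]; omega
    · intro z ⟨h1, h2, h3, h4⟩; rw [Finset.mem_coe, hmemΦ]; omega
    · exact (Set.finite_Icc (![X, -1] : Site 2) ![X', H]).subset fun z ⟨h1, h2, h3, h4⟩ => by
        simp only [Set.mem_Icc, Pi.le_def, Fin.forall_fin_two, Matrix.cons_val_zero, Matrix.cons_val_one]; omega
    · intro z ⟨h1, h2, h3, h4⟩; rw [Finset.mem_coe, hmemΦ]; omega
  have hdetA : DeterminedBy Ar (↑hTfin.toFinset.sym2 : Set (Sym2 (Site 2))) :=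
    Indep.determinedBy_openCrossing_finite hTfin _ _
  have hdisj : Disjoint (dualEdge ⁻¹' (↑Φ.sym2 : Set (Sym2 (Site 2)))) (↑hTfin.toFinset.sym2 : Set (Sym2 (Site 2))) := by
    refine Set.disjoint_left.2 fun e heΦ heT => ?_
    rw [mem_preimage, Finset.mem_coe, Finset.mem_sym2_iff] at heΦ
    rw [Finset.mem_coe, Finset.mem_sym2_iff] at heT
    obtain ⟨w, hwd, hwe⟩ := stub_dualEdge_shares e
    have hwΦ := (hmemΦ w).1 (heΦ w hwd)
    have hwT : w ∈ T := by simpa using heT w hwe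
    rcases hwT with (⟨h1, h2, h3, h4⟩ | ⟨h1, h2, h3, h4⟩) | ⟨h1, h2, h3, h4⟩ <;> omega
  have hUm : MeasurableSet U :=
    measurable_dualConfig (((measurableSet_openCrossing_of_countable _ _ _).inter
      (measurableSet_openCrossing_of_countable _ _ _)).inter (measurableSet_openCrossing_of_countable _ _ _))
  have hAm : MeasurableSet Ar := measurableSet_openCrossing_of_countable _ _ _
  have hind : μ.real (U ∩ Ar) = μ.real U * μ.real Ar :=
    bondPercolation_real_inter_of_disjoint (zdGraph 2) half hdisj hdetU hdetA hUm hAm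
  -- (3) conclusion
  calc cU * cA ≤ μ.real U * μ.real Ar := mul_le_mul hUn hAn hcA0.le measureReal_nonneg
    _ = μ.real (U ∩ Ar) := hind.symm
    _ ≤ _ := by
        rw [measureReal_def, measureReal_def]
        exact ENNReal.toReal_mono (measure_ne_top _ _) (measure_mono_ae hincl)

/-- **STUB W7 (registered signature): joint subsequential limits are STRICTLY increasing in the fourth
mark.** [folklore] -/
theorem stub_jointLimit_strictMono :
    ∀ {θ : ℕ → ℕ} {G : ℝ → ℝ → ℝ → ℝ → ℝ},
      (∀ a b c y : ℝ, a < b → b < c → c < y →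
        Tendsto (fun n ↦ μ.real (openCrossing halfPlane (arcA a b (θ n))
          (rowIcc ⌊c * (θ n : ℕ)⌋ ⌊y * (θ n : ℕ)⌋))) atTop (𝓝 (G a b c y))) →
      StrictMono θ → ∀ {a b c x y : ℝ}, a < b → b < c → c < x → x < y → G a b c x < G a b c y := by
  intro θ G hG hθ a b c x y hab hbc hcx hxy
  obtain ⟨c₀, hc₀, hev⟩ := stub_windowLowerBound a b c x y hab hbc hcx hxy
  have hdiff : ∀ n : ℕ, μ.real (openCrossing halfPlane (arcA a b n) (rowIcc ⌊c * n⌋ ⌊y * n⌋) \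
        openCrossing halfPlane (arcA a b n) (rowIcc ⌊c * n⌋ ⌊x * n⌋)) =
      μ.real (openCrossing halfPlane (arcA a b n) (rowIcc ⌊c * n⌋ ⌊y * n⌋)) -
        μ.real (openCrossing halfPlane (arcA a b n) (rowIcc ⌊c * n⌋ ⌊x * n⌋)) := by
    intro n
    refine measureReal_sdiff ?_ (measurableSet_openCrossing_of_countable _ _ _)
    refine openCrossing_mono subset_rfl subset_rfl fun v ⟨h1, h2, h3⟩ => ⟨h1, h2, h3.trans ?_⟩
    exact Int.floor_le_floor (by nlinarith [(Nat.cast_nonneg n : (0:ℝ) ≤ n)])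
  have hlim : Tendsto (fun n ↦ μ.real (openCrossing halfPlane (arcA a b (θ n)) (rowIcc ⌊c * (θ n : ℕ)⌋ ⌊y * (θ n : ℕ)⌋)) -
      μ.real (openCrossing halfPlane (arcA a b (θ n)) (rowIcc ⌊c * (θ n : ℕ)⌋ ⌊x * (θ n : ℕ)⌋))) atTop
      (𝓝 (G a b c y - G a b c x)) :=
    (hG a b c y hab hbc (hcx.trans hxy)).sub (hG a b c x hab hbc hcx)
  have hge : c₀ ≤ G a b c y - G a b c x := by
    refine ge_of_tendsto hlim ?_
    filter_upwards [hθ.tendsto_atTop.eventually hev] with n hn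
    rw [← hdiff (θ n)]
    exact hn
  linarith


end Window

end Summit.CriticalPhenomena.CardyFormulaZ2.Cruxes.HalfPlaneMarkDensityLaw.SketchLine
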